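import Summits.QuantumFields.YangMills.Theses.ThermalRuler
import Literature.MathematicalPhysics.QuantumFieldTheory.CurvatureGaussianField

/-!
# Birth skeleton (BC3) for crux `SofteningCentreBlind` (stmt-QuantumFields-10418) — `Lines/birth.lean`

Registrar: `planner-skel-stmt-QuantumFields-10418-0` (skeleton-register one-shot; route
`route-QuantumFields-ThermalRuler`, re-audit bin REPAIRABLE), 2026-08-17.

Crux (route file `Theses/ThermalRuler.lean`, decl
`Summit.QuantumFields.YangMills.Theses.ThermalRuler.SofteningCentreBlind`, rank 7, open-problem as
carded): for every compact simple Lie group `G` and faithful unitary lattice representation `r`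
on which no central element acts by a scalar `≠ 1`, every sequence of admissible STRONG decay rates
`m_k ∈ (0,1]` (Chatterjee 2021 Def. 2.3 with `K₁ = 4`: covariances of edge-local observables bounded
by `1`, in EVERY cube `v + [0,M]⁴` with EVERY boundary datum `η`, are `≤ 4·exp(−m_k·dist)`) along
couplings `b_k → ∞` tends to `0`.  The route header offered no mechanism ("softening must come from
asymptotic freedom itself").  The refuter's crux attack (item evidence `Swallow.lean`, rc 0,
sorry-free) showed the centre-blind hypothesis is IDLE (`SofteningCentreBlind ↔ SofteningAll` via
`r ↦ r ⊕ 1`); consistently, the line below never uses it and proves softening for every `(G, r)`.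

## The mechanism: a weak-coupling covariance FLOOR kills every uniform exponential rate

Chatterjee's strong decay quantifies over ALL cubes and ALL boundary data with a FIXED prefactor
`K₁ = 4`; it therefore also bounds the covariance of two plaquette observables at the centre of a
SMALL cube with FLAT boundary data (`η ≡ 1`, cold wall).  At weak coupling such a cube is
Gaussian-dominated: in complete axial gauge around the unique flat minimiser the `√β`-rescaled
plaquette variables are `D = dim G` copies of the Dirichlet lattice Maxwell field strength, and
Wick's formula gives, for the normalised plaquette actions `f_i = (1 − Re tr r.ρ(U_{p_i})/N)/2`
of two `(1,2)`-plaquettes separated by `n e₀`,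

  `Cov(f₁, f₂) = D·Π_M(p₁,p₂)² / (8 N² β²) · (1 + o(1))`,   `Π_M → c_n = curvaturePlaquetteCorr 4 n ≍ 1/(π² n⁴)`,

a POWER LAW in the separation.  In a cube of side `M = ⌈β^θ⌉` (`θ > 0` small) with `n = ⌈β^{θ/2}⌉`
this floor `ε(β) ≍ β^{−2−4θ}` at distance `R(β) = β^{θ/2}` is incompatible with `4·e^{−m R}`
unless `m ≤ log(4/ε(β))/R(β) ≍ (2 + 4θ)·log β / β^{θ/2} → 0`.  No confinement physics, no
renormalisation group: the strong (boundary-uniform) mixing length is forced to diverge by the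
perturbative short-distance regime alone — which is exactly why the STRONG form of softening is
weaker than Chatterjee's Problem 5.1 (`ξ_bulk(β) → ∞`), and why this crux is attackable.

## The cut (two stubs, glue proved here)

* `stub_curvatureCorrFloor` (F1 — LATTICE POTENTIAL THEORY, known in print, not in tree; size L).
  `∃ κ > 0, ∃ n₀, ∀ n ≥ n₀, κ/n⁴ ≤ |c_n|` for the tree's `c_n = curvaturePlaquetteCorr 4 n`
  (`CurvatureGaussianField.lean`: the field-strength two-point number of the massless lattice
  `1`-form GFF between the `(1,2)`-plaquettes at `0` and `n e₀`; `c_0 = 2/d` proved there).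
  `c_n = −(Δ₁ + Δ₂)G₀(n e₀)` with `G₀ = (−Δ_{ℤ⁴})⁻¹ = latticeGreen/2`, so this is the SECOND-DIFFERENCE
  asymptotics of the lattice Green function, `∇²_y G(x) = a_d|y|² D_{uu}|x|^{2−d} + O(|x|^{−d−1})`
  (Lawler 1991, *Intersections of Random Walks*, Thm 1.5.5 (1.37), read in the held text p. 21),
  giving `c_n = 1/(π² n⁴) + O(n⁻⁵)`; the tree has the undifferenced expansion
  `Literature.Probability.LatticeModels.latticeGreen_asymptotics` with its heat-kernel machinery.
  Numerics (registrar, exact 1-D resolvent + 3-D midpoint rule): `π² n⁴ c_n = 0.680, 1.761, 1.530,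
  1.092, 1.020, 1.005, 1.003` at `n = 1, 2, 4, 8, 16, 32, 48`; `c_n > 0.68/(π² n⁴)` for all
  `1 ≤ n ≤ 64` computed.  Why it might fail: only through a normalisation slip (it cannot: `|·|`
  and an unspecified `κ`); the content is the `O(|x|^{−5})` control of second differences.
* `stub_covarianceFloor` (F2 — WEAK-COUPLING COVARIANCE FLOOR IN A DIRICHLET CUBE; the
  load-bearing, constructive stub; size L–XL).  GIVEN F1: for every compact simple `G` and
  faithful unitary `r` there are `β₁` and profiles `R, ε : ℝ → ℝ` with `log(4/ε(β))/R(β) → 0`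
  such that for every `β ≥ β₁` some Chatterjee cube (`M`, `v`, interior edge set `Λ` — the crux's
  own filter expression), boundary datum `η`, admissible edges `e₁, e₂` and admissible edge-local
  observables `f, g` (measurable, cylinder on the plaquette-neighbourhoods, `|f|, |g| ≤ 1`) have
  `‖e₁.1 − e₂.1‖ ≥ R(β)` and `|E[fg] − E[f]E[g]| ≥ ε(β) > 0` under `ymSpecification r.ρ β Λ η`.
  Intended witness: flat data, `M = ⌈β^θ⌉`, the two central `(1,2)`-plaquette actions at separation
  `n = ⌈β^{θ/2}⌉ e₀`, `ε(β) = β^{−2−4θ}·const`, `R(β) = n`.  Intended proof (one scale, no RG):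
  (i) large-field bound `Z_{≥δ}/Z ≤ exp(−βδ² + O(M⁴ log β))` from Haar small-ball volumes
  (tree `Literature.Barriers.QuantumFields.UnitaryHaarSmallBall`: `μ{‖V−1‖ ≤ ρ} ≥ (ρ/(2π+ρ))^{N²}`)
  with `δ² = β^{−1+2ε}`; (ii) complete axial gauge on the cube (exact on the lattice, no Jacobian)
  and the lattice non-abelian Poincaré lemma (small plaquettes ⇒ tree-gauge links within
  `M^a·δ` of `1`); (iii) second-order Taylor expansion of action, observables and Haar density
  around the flat configuration, with SUP-NORM remainders `O(M^{4+3a} β^{−1/2+3ε})` — affordable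
  because the target `Cov_γ(βS_{p₁}, βS_{p₂}) = (D/(2N²))·Π_M² ≍ n⁻⁸ = β^{−4θ}` is only
  polynomially small and `θ` is free; (iv) Wick's formula for the Gaussian; (v) Dirichlet
  correction `|Π_M(p₁,p₂) − c_n| = O(M⁻⁴) = O(n⁻⁸) ≪ κ n⁻⁴` (F1) at the centre.
  Why it might fail: mathematically low-risk (fixed-`M` Laplace asymptotics are classical; the
  uniformity needed is only `M ≤ β^θ` with `θ` as small as desired), but the formalisation is heavy:
  tree gauge + Poincaré lemma with polynomial loss, the tilted glued product-Haar kernel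
  `ymSpecification`, and a dimension-uniform Laplace expansion; a sign/normalisation accident is
  excluded by stating `|Cov| ≥ ε` existentially.
* Glue (PROVED here, `sorry`-free): `rate_le_of_floor` (`0 < R₀ ≤ D`, `0 < ε₀ ≤ c ≤ 4e^{−mD}`,
  `0 < m` ⇒ `m ≤ log(4/ε₀)/R₀`) and `glue : Glue` (`Glue := F1-sig → F2-sig → SofteningCentreBlind`):
  fix `G`, `r`, `b_k → ∞`, admissible `m_k`; eventually `b_k ≥ β₁`, instantiate the crux's own
  decay hypothesis at F2's witness cube, get `m_k ≤ log(4/ε(b_k))/R(b_k)`, and squeeze between `0`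
  and `(log(4/ε)/R) ∘ b → 0`.  `SofteningCentreBlind_of : SofteningCentreBlind := glue stub… stub…`
  is the registered form (concludes the crux BY NAME; sorries only in the two stubs).

Neither stub is the crux or the summit in disguise: F1 is a statement about the lattice Green
function (no gauge theory); F2 is a LOWER bound on ONE covariance per coupling (the crux is an
upper-bound-implies-softening statement about all of them) and does not mention sequences, rates,
OS data or `YangMills`.  BC3 probes (registrar folder `bc/`, route file + `CurvatureGaussianField`
imported, NOT this skeleton; `maxHeartbeats 400000`): `first | exact? | simpa using h | aesop` —
4/4 FAIL (F1→crux, F1→YangMills, F2→crux, F2→YangMills: `exact?`/`simpa` fail, aesop "failed to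
prove the goal after exhaustive search", unsolved `⊢ SofteningCentreBlind` / `⊢ YangMills`);
pure `aesop (enableSimp := false)` 4/4 FAIL; converses `crux → F1`, `crux → F2` by `exact?` FAIL.
Raw outputs: `Lines/birth.md`.

## Disproof used / negatives / barriers

No `Disproof.lean`, no `Theorems/SofteningCentreBlind/Negative/`, no earlier workfiles for this crux
(`ledger crux ls stmt-QuantumFields-10418`, 2026-08-17).  Negatives index (5 refuted statements:
RobustYangMillsRG, DiagonalMirrorRP, AdaptiveCoarseSystem, MultibosonLatticeGap, AdmissibleRootsExist):
nothing on weak-coupling covariance floors or Green-function asymptotics; the refuted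
plaquette-covariance POSITIVITY claims of route GluonFreeDual (toron anticorrelation,
`Literature.Barriers.QuantumFields.ToronPlaneAnticorrelation`) are respected: both stubs bound
ABSOLUTE values, F1 concerns the Gaussian kernel and F2 a Dirichlet (not periodic) cube.
Barriers: `PerturbativeInvisibility` (the gap is invisible to perturbation theory) — not engaged:
perturbation theory is used only for a LOWER bound on correlations, i.e. an UPPER bound on the
strong rate; `ElitzurTheorem` — the witnesses are gauge-invariant plaquette actions;
`FixedCouplingUltralocality` / `FiniteTemperatureDeconfinement` — not in play (no continuum limit,
no thermal geometry).  Sibling statements in the tree (not usable as is): `DirichletWindow.BoxLaplace`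
birth stub `stub_flatBoxGaussianity` (flat box conditioned on the small-field event, FIXED
separation `n` then `β → ∞` — no uniformity in `n ≤ β^{θ/2}`, other edge set) and
`XiCompleteMonotonicity.FixedDistanceLower` (infinite-volume limit states — much stronger).

`lean check`: rc 0; sorries = 2 = stubs (`stub_curvatureCorrFloor`, `stub_covarianceFloor`), zero
elsewhere (`rate_le_of_floor`, `glue` kernel-closed).  Namespace
`Summit.QuantumFields.YangMills.Cruxes.SofteningCentreBlind.Birth`.
-/

set_option autoImplicit false

noncomputable section

namespace Summit.QuantumFields.YangMills.Cruxes.SofteningCentreBlind.Birth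

open Filter Topology MeasureTheory
open Summit.QuantumFields.YangMills.Theses.ThermalRuler (SofteningCentreBlind)

/-! ## The two stubs (signatures fully qualified and self-contained, like the crux) -/

/-- **Stub F1 — power-law floor of the lattice Maxwell curvature two-point function (`d = 4`).**
There are `κ > 0` and `n₀` with `κ / n⁴ ≤ |c_n|` for all `n ≥ n₀`, where
`c_n = curvaturePlaquetteCorr 4 n = Cov(Y¹_{(0;1,2)}, Y¹_{(n e₀;1,2)})` is the tree's field-strength
two-point number of the massless lattice `1`-form Gaussian free field (`= −(Δ₁+Δ₂)G₀(n e₀)`,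
`G₀ = (−Δ_{ℤ⁴})⁻¹`).  Continuum value `1/(π² n⁴)`; numerically `π² n⁴ c_n → 1⁺`
(`1.092, 1.020, 1.005` at `n = 8, 16, 32`).  Second-difference Green asymptotics: Lawler 1991,
Thm 1.5.5 (1.37). -/
theorem stub_curvatureCorrFloor :
    ∃ κ : ℝ, 0 < κ ∧ ∃ n₀ : ℕ, ∀ n : ℕ, n₀ ≤ n → κ / (n : ℝ) ^ 4 ≤ |Literature.MathematicalPhysics.QuantumFieldTheory.curvaturePlaquetteCorr (d := 4) (by norm_num) (n : ℤ)| := by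
  sorry

/-- **Stub F2 — weak-coupling covariance floor in a Dirichlet cube (load-bearing).**  Given F1:
for every compact simple `G` and faithful unitary `r` there are `β₁` and profiles `R ε : ℝ → ℝ`
with `log(4/ε β)/R β → 0` (`β → ∞`) such that for every `β ≥ β₁`, `0 < R β`, `0 < ε β`, and SOME
Chatterjee cube `v + [0,M]⁴` (interior edge set `Λ`, the crux's own filter expression), boundary
datum `η`, admissible edges `e₁, e₂` of the cube and admissible edge-local observables `f, g`
(measurable, cylinder on the plaquette-neighbourhoods of `e₁`, `e₂`, bounded by `1`) satisfy
`R β ≤ ‖e₁.1 − e₂.1‖` and `ε β ≤ |E[fg] − E[f]E[g]|` under `ymSpecification r.ρ β Λ η`.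
Intended witness: flat data `η ≡ 1`, `M = ⌈β^θ⌉`, the two central `(1,2)`-plaquette actions
`(1 − Re tr r.ρ(U_p)/N)/2` at separation `⌈β^{θ/2}⌉ e₀`, `ε β ≍ β^{−2−4θ}` (Gaussian domination:
`Cov ≈ D Π_M²/(8N²β²)`, `Π_M ≈ c_n ≍ n⁻⁴` by F1). -/
theorem stub_covarianceFloor :
    (∃ κ : ℝ, 0 < κ ∧ ∃ n₀ : ℕ, ∀ n : ℕ, n₀ ≤ n → κ / (n : ℝ) ^ 4 ≤ |Literature.MathematicalPhysics.QuantumFieldTheory.curvaturePlaquetteCorr (d := 4) (by norm_num) (n : ℤ)|) → ∀ (G : Type) [Group G] [TopologicalSpace G] [IsTopologicalGroup G] [CompactSpace G] [MeasurableSpace G] [BorelSpace G], Literature.MathematicalPhysics.QuantumFieldTheory.IsCompactSimpleLieGroup G → ∀ r : Literature.MathematicalPhysics.QuantumFieldTheory.LatticeRep G, ∃ (β₁ : ℝ) (R ε : ℝ → ℝ), Filter.Tendsto (fun β : ℝ => Real.log (4 / ε β) / R β) Filter.atTop (nhds 0) ∧ ∀ β : ℝ, β₁ ≤ β → 0 <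 R β ∧ 0 < ε β ∧ ∃ (M : ℕ) (v : Fin 4 → ℤ) (Λ : Finset (Literature.MathematicalPhysics.QuantumLattice.ZdEdge 4)) (η : Literature.MathematicalPhysics.QuantumLattice.LGConfig 4 G) (e₁ e₂ : Literature.MathematicalPhysics.QuantumLattice.ZdEdge 4) (f g : Literature.MathematicalPhysics.QuantumLattice.LGConfig 4 G → ℝ), Λ = (((Fintype.piFinset fun j : Fin 4 => Finset.Icc (v j) (v j + M)) ×ˢ (Finset.univ : Finset (Fin 4))).filter fun e => e.1 e.2 + 1 ≤ v e.2 + M ∧ ∀ j, j ≠ e.2 → v j < e.1 j ∧ e.1 j < v j + M) ∧ (∀ j, v j ≤ e₁.1 j ∧ e₁.1 j ≤ v j + M) ∧ e₁.1 e₁.2 + 1 ≤ v e₁.2 + M ∧ (∀ j, v j ≤ e₂.1 j ∧ e₂.1 j ≤ v j + M) ∧ e₂.1 e₂.2 + 1 ≤ v e₂.2 + M ∧ Measurable f ∧ Measurable g ∧ Literature.MathematicalPhysics.QuantumLattice.IsCylinder f ((Literature.MathematicalPhysics.QuantumLattice.plaquettesTouching {e₁}).biUnion Literature.MathematicalPhysics.QuantumLattice.plaquetteEdges)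 ∧ Literature.MathematicalPhysics.QuantumLattice.IsCylinder g ((Literature.MathematicalPhysics.QuantumLattice.plaquettesTouching {e₂}).biUnion Literature.MathematicalPhysics.QuantumLattice.plaquetteEdges) ∧ (∀ U, |f U| ≤ 1) ∧ (∀ U, |g U| ≤ 1) ∧ R β ≤ ‖e₁.1 - e₂.1‖ ∧ ε β ≤ |(∫ U, f U * g U ∂(Literature.MathematicalPhysics.QuantumLattice.ymSpecification (d := 4) r.ρ β Λ η)) - (∫ U, f U ∂(Literature.MathematicalPhysics.QuantumLattice.ymSpecification (d := 4) r.ρ β Λ η)) * (∫ U, g U ∂(Literature.MathematicalPhysics.QuantumLattice.ymSpecification (d := 4) r.ρ β Λ η))| := by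
  sorry

/-! ## The glue (proved): a floor bounds every admissible strong rate; then squeeze along `b_k → ∞` -/

/-- **Rate bound from a floor.**  If `0 < R₀ ≤ D`, `0 < ε₀ ≤ c` and `c ≤ 4·exp(−m D)` with
`0 < m`, then `m ≤ log(4/ε₀)/R₀`.  (The one place where Chatterjee's inequality is inverted.) -/
theorem rate_le_of_floor {R₀ ε₀ m D c : ℝ} (hR : 0 < R₀) (hε : 0 < ε₀) (hm : 0 < m)
    (hRD : R₀ ≤ D) (hfloor : ε₀ ≤ c) (hdecay : c ≤ 4 * Real.exp (-(m * D))) :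
    m ≤ Real.log (4 / ε₀) / R₀ := by
  have h1 : ε₀ ≤ 4 * Real.exp (-(m * R₀)) := by
    refine hfloor.trans (hdecay.trans ?_)
    exact mul_le_mul_of_nonneg_left
      (Real.exp_le_exp.2 (neg_le_neg (mul_le_mul_of_nonneg_left hRD hm.le))) (by norm_num)
  have h2 : ε₀ / 4 ≤ Real.exp (-(m * R₀)) := by
    rw [div_le_iff₀ (by norm_num : (0 : ℝ) < 4)]
    linarith
  have h3 : Real.log (ε₀ / 4) ≤ -(m * R₀) := by
    have := Real.log_le_log (by positivity) h2
    rwa [Real.log_exp] at this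
  have h4 : m * R₀ ≤ Real.log (4 / ε₀) := by
    rw [Real.log_div (by norm_num) hε.ne']
    rw [Real.log_div hε.ne' (by norm_num)] at h3
    linarith
  exact (le_div_iff₀ hR).2 h4

/-- **The glue statement**: the two stub SIGNATURES (verbatim) imply the crux. -/
def Glue : Prop :=
    (∃ κ : ℝ, 0 < κ ∧ ∃ n₀ : ℕ, ∀ n : ℕ, n₀ ≤ n → κ / (n : ℝ) ^ 4 ≤ |Literature.MathematicalPhysics.QuantumFieldTheory.curvaturePlaquetteCorr (d := 4) (by norm_num) (n : ℤ)|) →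
    ((∃ κ : ℝ, 0 < κ ∧ ∃ n₀ : ℕ, ∀ n : ℕ, n₀ ≤ n → κ / (n : ℝ) ^ 4 ≤ |Literature.MathematicalPhysics.QuantumFieldTheory.curvaturePlaquetteCorr (d := 4) (by norm_num) (n : ℤ)|) → ∀ (G : Type) [Group G] [TopologicalSpace G] [IsTopologicalGroup G] [CompactSpace G] [MeasurableSpace G] [BorelSpace G], Literature.MathematicalPhysics.QuantumFieldTheory.IsCompactSimpleLieGroup G → ∀ r : Literature.MathematicalPhysics.QuantumFieldTheory.LatticeRep G, ∃ (β₁ : ℝ) (R ε : ℝ → ℝ), Filter.Tendsto (fun β : ℝ => Real.log (4 / ε β) / R β) Filter.atTop (nhds 0) ∧ ∀ β : ℝ, β₁ ≤ β → 0 < R β ∧ 0 < ε β ∧ ∃ (M : ℕ) (v : Fin 4 → ℤ) (Λ : Finset (Literature.MathematicalPhysics.QuantumLattice.ZdEdge 4)) (η : Literature.MathematicalPhysics.QuantumLattice.LGConfig 4 G) (e₁ e₂ : Literature.MathematicalPhysics.QuantumLattice.ZdEdge 4) (f g : Literature.MathematicalPhysics.QuantumLattice.LGConfig 4 G → ℝ),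 Λ = (((Fintype.piFinset fun j : Fin 4 => Finset.Icc (v j) (v j + M)) ×ˢ (Finset.univ : Finset (Fin 4))).filter fun e => e.1 e.2 + 1 ≤ v e.2 + M ∧ ∀ j, j ≠ e.2 → v j < e.1 j ∧ e.1 j < v j + M) ∧ (∀ j, v j ≤ e₁.1 j ∧ e₁.1 j ≤ v j + M) ∧ e₁.1 e₁.2 + 1 ≤ v e₁.2 + M ∧ (∀ j, v j ≤ e₂.1 j ∧ e₂.1 j ≤ v j + M) ∧ e₂.1 e₂.2 + 1 ≤ v e₂.2 + M ∧ Measurable f ∧ Measurable g ∧ Literature.MathematicalPhysics.QuantumLattice.IsCylinder f ((Literature.MathematicalPhysics.QuantumLattice.plaquettesTouching {e₁}).biUnion Literature.MathematicalPhysics.QuantumLattice.plaquetteEdges) ∧ Literature.MathematicalPhysics.QuantumLattice.IsCylinder g ((Literature.MathematicalPhysics.QuantumLattice.plaquettesTouching {e₂}).biUnion Literature.MathematicalPhysics.QuantumLattice.plaquetteEdges) ∧ (∀ U, |f U| ≤ 1) ∧ (∀ U, |g U| ≤ 1) ∧ R β ≤ ‖e₁.1 - e₂.1‖ ∧ ε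 β ≤ |(∫ U, f U * g U ∂(Literature.MathematicalPhysics.QuantumLattice.ymSpecification (d := 4) r.ρ β Λ η)) - (∫ U, f U ∂(Literature.MathematicalPhysics.QuantumLattice.ymSpecification (d := 4) r.ρ β Λ η)) * (∫ U, g U ∂(Literature.MathematicalPhysics.QuantumLattice.ymSpecification (d := 4) r.ρ β Λ η))|) →
    SofteningCentreBlind

/-- **The glue, `sorry`-free.**  Fix `G`, `hG`, `r`, couplings `b_k → ∞` and admissible rates
`m_k`; F2 (fed with F1) gives `β₁, R, ε` and witnesses; for `b_k ≥ β₁` the crux's own decay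
hypothesis at the witness cube and `rate_le_of_floor` give `m_k ≤ log(4/ε(b_k))/R(b_k)`; squeeze
between `0` and `(fun β ↦ log(4/ε β)/R β) ∘ b → 0`.  The centre-blind hypothesis is not used. -/
theorem glue : Glue := by
  intro hF1 hF2 G _ _ _ _ hG
  letI : MeasurableSpace G := borel G
  haveI : BorelSpace G := ⟨rfl⟩
  intro r _hcb b m hb hm
  obtain ⟨β₁, R, ε, hT, hW⟩ := hF2 hF1 G hG r
  have hev : ∀ᶠ k in atTop, m k ≤ Real.log (4 / ε (b k)) / R (b k) := by
    filter_upwards [hb.eventually_ge_atTop β₁] with k hk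
    obtain ⟨hR, hε, M, v, Λ, η, e₁, e₂, f, g, hΛ, he₁, he₁', he₂, he₂', hf, hg, hfc, hgc, hfb, hgb,
      hdist, hfloor⟩ := hW (b k) hk
    obtain ⟨hm0, -, hsed⟩ := hm k
    exact rate_le_of_floor hR hε hm0 hdist hfloor
      (hsed M v Λ η e₁ e₂ f g hΛ he₁ he₁' he₂ he₂' hf hg hfc hgc hfb hgb)
  exact tendsto_of_tendsto_of_tendsto_of_le_of_le' tendsto_const_nhds (hT.comp hb)
    (Eventually.of_forall fun k => (hm k).1.le) hev

/-- **Composition (registered form)** — the two stubs BY NAME give the crux BY NAME. -/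
theorem SofteningCentreBlind_of : SofteningCentreBlind :=
  glue stub_curvatureCorrFloor stub_covarianceFloor

/-- Signature match: the registered composition has literally the route's crux as its type. -/
example : Summit.QuantumFields.YangMills.Theses.ThermalRuler.SofteningCentreBlind :=
  SofteningCentreBlind_of

end Summit.QuantumFields.YangMills.Cruxes.SofteningCentreBlind.Birth

end
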